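import Literature.Analysis.Asymptotics.LaplaceMethodOrbitConstant
import Literature.MathematicalPhysics.QuantumFieldTheory.Balaban1983to89.HaarExponentialChartGlobal
import Literature.MathematicalPhysics.QuantumFieldTheory.Balaban1983to89.LogChartProduct
import HarnessLib

/-!
# The window constant `σ₀` of Haar measure in exponential coordinates: limit characterisation, scaling in the
# reference measure and in the frame, and the PRODUCT FORMULA `σ₀(G^B) = σ₀(G)^{|B|}`

Topic `Literature/MathematicalPhysics/QuantumFieldTheory/Balaban1983to89`; namespace
`Literature.MathematicalPhysics.QuantumFieldTheory.Balaban1983to89.HaarWindowConstLimit`.  Everything here is PROVED;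
no definitions, no named facts.

THE OBJECT.  For a compact group `G` faithfully represented on a log-charted linear group (`h : IsChartRep C ρ`,
`hlie`), a Haar measure `μ` on `G` and a reference measure `η` on the Lie algebra `𝔤 = C.lie`, the tree's WINDOW
CONSTANT is `σ₀(η) = μ(V_s) ∕ ν_s(V_s)` (`V_s = Θ(B(0,s))` the canonical window, `ν_s = Θ_*(|det jac| dη|_{B(0,s)})` the
chart measure; independent of `0 < s ≤ s_C` by `IsChartRep.windowConst_eq_div`) — Helgason's «`σ₀ = σ(0)`», the
density of Haar measure at the unit in canonical coordinates [Helgason2000, Ch. I §1 Thm 1.14 (13); Balaban1985UV3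
p. 260].  It is the constant `h(0)` of `LaplaceMethodOrbitConstant.windowConst_ratio_eq_of_continuous` and the `J(0)` of
the fibred slice charts of cell `ym-ir`; a consumer forming RATIOS of Laplace constants of different boxes needs its
behaviour under (a) rescaling `η`, (b) changing the Euclidean frame, (c) taking products of groups.

RESULTS.
* §1 ★ `tendsto_haar_window_div` — **`σ₀` is a derivative**: `μ(V_r) ∕ η(B(0,r)) ⟶ σ₀(η)` as `r → 0⁺`
  (`μ(V_r) = σ₀ ∫_{B(0,r)} |det jac| dη` by `IsChartRep.haar_image_eq`, and the average of the continuous density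
  `|det jac|`, `= 1` at `0`, tends to `1` — `tendsto_setIntegral_div_measureReal_ball`).
* §2 (W-N1) `chartMeasure_smul`, ★ `windowConst_smul_toReal` (`σ₀(c • η) = σ₀(η) ∕ c`), ★ `windowConst_map_frame_comp`
  (frames `e, e ∘ A : V ≃L 𝔤`: `σ₀(vol_V ∘ (e∘A)⁻¹) = |det A| · σ₀(vol_V ∘ e⁻¹)`), `windowConst_map_frame_comp_linearIsometryEquiv`
  (an isometric change of model space does not change `σ₀`).
* §3 (W-N2) ★★ `windowConst_pi_toReal` — **PRODUCT FORMULA**: for the product chart `isChartRep_pi B h` of `G^B` with the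
  product Haar measure `⊗_b μ` and the product reference measure `(⊗_b η)` transported to `𝔤^B` along `lieEquivPi`,
  `σ₀(G^B) = σ₀(G)^{|B|}`.  Proof without any «`jac` of the product chart is the product of the `jac`s» identity: the
  product window is the product of the windows (`window_pi_eq`, the sup norm), so `μ_B(V^B_r) ∕ λ_B(B^B(0,r)) =
  (μ(V_r) ∕ η(B(0,r)))^{|B|}` for small `r`, and both sides of the formula are the `r → 0⁺` limits of §1.

HONEST SCOPE.  Measure-theoretic bookkeeping of a normalisation constant; `σ₀` is characterised and transformed, not
evaluated (the explicit values are the `HaarDensity*Explicit` files).  Nothing here bears on the Yang–Mills mass gap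
(Clay), which is NOT proved; in cell `ym-ir` the rung served (`R4`) closes only the conditional finite-`𝕋⁴` statement
`BalabanLadder.UV`.

## References
* S. Helgason, *Groups and Geometric Analysis* (2000), Ch. I §1 Thm 1.14 (12)–(13) p. 96. [Helgason2000]
* T. Bałaban, CMP 102 (1985) 255–275, p. 260 and (18) (the product over the bond set, factor `σ₀^{|Ω₁|}`). [Balaban1985UV3]
-/

noncomputable section

open _root_.MeasureTheory _root_.MeasureTheory.Measure _root_.Filter _root_.Set _root_.Metric
open scoped _root_.Topology _root_.ENNReal _root_.NNReal
open Literature.Analysis.Asymptotics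
open Literature.MathematicalPhysics.QuantumFieldTheory.Balaban1983to89.HaarExponentialChart
open Literature.MathematicalPhysics.QuantumFieldTheory.Balaban1983to89.LogChartProduct
open Literature.MathematicalPhysics.QuantumFieldTheory.Balaban1983to89.B13HaarSigmaJacobian (jac det_jac_zero)

namespace Literature.MathematicalPhysics.QuantumFieldTheory.Balaban1983to89.HaarWindowConstLimit

variable {𝔸 : Type*} [NormedRing 𝔸] [NormedAlgebra ℂ 𝔸] [CompleteSpace 𝔸]
variable {G : Type*} [Group G] [TopologicalSpace G] [IsTopologicalGroup G] [CompactSpace G]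
  [MeasurableSpace G] [BorelSpace G]
variable {C : LogChart 𝔸} {ρ : G →* 𝔸} (h : IsChartRep C ρ) [FiniteDimensional ℝ C.lie]
  (hlie : ∀ x ∈ C.lie, ∀ y ∈ C.lie, x * y - y * x ∈ C.lie)
variable [MeasurableSpace C.lie] [BorelSpace C.lie] (η : Measure C.lie) [η.IsAddHaarMeasure]
variable (μ : Measure G) [μ.IsHaarMeasure]

/-! ## §1 The window constant as the derivative of Haar measure through the chart -/

/-- The window measure in coordinates, real form: for `0 < r ≤ s_C`,
`μ(V_r) = σ₀ · ∫_{B(0,r)} |det jac X| dη(X)` (real numbers). [cite: Helgason2000, Ch. I §1 Thm 1.14 (13) p. 96]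
[cite: Balaban1985UV3, p. 260] -/
theorem measureReal_window_eq {s : ℝ} (hs0 : 0 < s) (hs : s ≤ IsChartRep.chartRadius C) {r : ℝ}
    (hr : r ≤ IsChartRep.chartRadius C) :
    (μ (h.window r)).toReal = (μ (h.window s) / h.chartMeasure hlie η s (h.window s)).toReal *
      ∫ X in ball (0 : C.lie) r, |LinearMap.det (jac hlie X : C.lie →ₗ[ℝ] C.lie)| ∂η := by
  have h1 := h.haar_image_eq hlie η μ hs0 hs (measurableSet_ball (x := (0 : C.lie)) (ε := r)) (h.injOn_expChart hr)
  have hdc : Continuous fun X : C.lie => |LinearMap.det (jac hlie X : C.lie →ₗ[ℝ] C.lie)| :=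
    continuous_abs.comp (continuous_det_jac hlie)
  have h2 : (∫⁻ X in ball (0 : C.lie) r, jacDensity hlie X ∂η).toReal =
      ∫ X in ball (0 : C.lie) r, |LinearMap.det (jac hlie X : C.lie →ₗ[ℝ] C.lie)| ∂η := by
    rw [integral_eq_lintegral_of_nonneg_ae (Eventually.of_forall fun X => abs_nonneg _)
      hdc.aestronglyMeasurable]
    rfl
  show (μ (h.expChart '' ball (0 : C.lie) r)).toReal = _
  rw [h1, ENNReal.toReal_mul, h2]

/-- ★ **`σ₀` is the derivative of Haar measure at the unit through the chart**: `μ(V_r) ∕ η(B(0,r)) ⟶ σ₀(η)` as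
`r → 0⁺`, for every additive Haar measure `η` on `𝔤` (indeed `μ(V_r) = σ₀ ∫_{B(0,r)} |det jac| dη` and the average of the
continuous density `|det jac|`, equal to `1` at `0`, tends to `1`). [cite: Helgason2000, Ch. I §1 Thm 1.14 (13) p. 96
(«σ₀ = σ(0)»)] [cite: Balaban1985UV3, p. 260] -/
theorem tendsto_haar_window_div {s : ℝ} (hs0 : 0 < s) (hs : s ≤ IsChartRep.chartRadius C) :
    Tendsto (fun r : ℝ => (μ (h.window r)).toReal / (η (ball (0 : C.lie) r)).toReal) (𝓝[>] 0)
      (𝓝 (μ (h.window s) / h.chartMeasure hlie η s (h.window s)).toReal) := by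
  set σ₀ : ℝ := (μ (h.window s) / h.chartMeasure hlie η s (h.window s)).toReal with hσ₀
  set d : C.lie → ℝ := fun X => |LinearMap.det (jac hlie X : C.lie →ₗ[ℝ] C.lie)| with hd
  have hdc : Continuous d := continuous_abs.comp (continuous_det_jac hlie)
  have hd0 : d 0 = 1 := by simp only [hd, det_jac_zero, abs_one]
  have havg := tendsto_setIntegral_div_measureReal_ball (κ := η) hdc.continuousAt one_pos
    ((hdc.continuousOn.integrableOn_compact (isCompact_closedBall (0 : C.lie) 1)).mono_set ball_subset_closedBall)
  rw [hd0] at havg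
  have hlim : Tendsto (fun r : ℝ => σ₀ * ((∫ X in ball (0 : C.lie) r, d X ∂η) / η.real (ball (0 : C.lie) r)))
      (𝓝[>] 0) (𝓝 (σ₀ * 1)) := havg.const_mul σ₀
  rw [mul_one] at hlim
  refine hlim.congr' ?_
  have hev : ∀ᶠ r in 𝓝[>] (0 : ℝ), r < IsChartRep.chartRadius C :=
    nhdsWithin_le_nhds (Iio_mem_nhds IsChartRep.chartRadius_pos)
  filter_upwards [hev] with r hr
  rw [measureReal_window_eq h hlie η μ hs0 hs hr.le, mul_div_assoc]
  rfl

/-! ## §2 (W-N1) Scaling: the reference measure and the frame -/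

omit [CompleteSpace 𝔸] [IsTopologicalGroup G] [CompactSpace G] [BorelSpace C.lie] [BorelSpace G]
  [η.IsAddHaarMeasure] in
/-- The chart measure is linear in the reference measure: `ν_s(c • η) = c • ν_s(η)`.
[cite: Helgason2000, Ch. I §1 Thm 1.14 (13) p. 96] -/
theorem chartMeasure_smul (c : ℝ≥0∞) (s : ℝ) : h.chartMeasure hlie (c • η) s = c • h.chartMeasure hlie η s := by
  simp only [IsChartRep.chartMeasure, Measure.restrict_smul, withDensity_smul_measure, Measure.map_smul]

omit [CompleteSpace 𝔸] [IsTopologicalGroup G] [CompactSpace G] [BorelSpace C.lie] [BorelSpace G]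
  [η.IsAddHaarMeasure] [μ.IsHaarMeasure] in
/-- ★ **Rescaling the reference measure divides `σ₀`**: `σ₀(c • η) = σ₀(η) ∕ c` (`0 < c < ∞`), as real numbers.
[cite: Helgason2000, Ch. I §1 Thm 1.14 (13) p. 96] [cite: Balaban1985UV3, p. 260] -/
theorem windowConst_smul_toReal (c : ℝ≥0∞) (s : ℝ) :
    (μ (h.window s) / h.chartMeasure hlie (c • η) s (h.window s)).toReal =
      (μ (h.window s) / h.chartMeasure hlie η s (h.window s)).toReal / c.toReal := by
  rw [chartMeasure_smul h hlie η c s, Measure.smul_apply, smul_eq_mul, ENNReal.toReal_div, ENNReal.toReal_div,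
    ENNReal.toReal_mul, div_mul_eq_div_div_swap]

section Frame

variable {V : Type*} [NormedAddCommGroup V] [InnerProductSpace ℝ V] [FiniteDimensional ℝ V]
  [MeasurableSpace V] [BorelSpace V]

omit [CompleteSpace 𝔸] [IsTopologicalGroup G] [CompactSpace G] [BorelSpace G] [μ.IsHaarMeasure] in
/-- ★ **Changing the Euclidean frame multiplies `σ₀` by the determinant**: for frames `e : V ≃L 𝔤` and `e ∘ A`
(`A : V ≃L V`), `σ₀(vol_V ∘ (e ∘ A)⁻¹) = |det A| · σ₀(vol_V ∘ e⁻¹)` (`(e∘A)_* vol = |det A|⁻¹ • e_* vol`).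
[cite: Helgason2000, Ch. I §1 Thm 1.14 (13) p. 96] [cite: Balaban1985UV3, p. 260 («dA′ is the Lebesgue measure on 𝔤»)] -/
theorem windowConst_map_frame_comp (e : V ≃L[ℝ] C.lie) (A : V ≃L[ℝ] V) (s : ℝ) :
    (μ (h.window s) / h.chartMeasure hlie ((volume : Measure V).map fun v => e (A v)) s (h.window s)).toReal =
      |LinearMap.det (A.toLinearEquiv : V →ₗ[ℝ] V)| *
        (μ (h.window s) / h.chartMeasure hlie ((volume : Measure V).map e) s (h.window s)).toReal := by
  have hdet : LinearMap.det (A.toLinearEquiv : V →ₗ[ℝ] V) ≠ 0 := A.toLinearEquiv.isUnit_det'.ne_zero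
  have h1 : ((volume : Measure V).map fun v => e (A v)) =
      ENNReal.ofReal |(LinearMap.det (A.toLinearEquiv : V →ₗ[ℝ] V))⁻¹| • (volume : Measure V).map e := by
    rw [show (fun v => e (A v)) = (e : V → C.lie) ∘ (A.toLinearEquiv : V →ₗ[ℝ] V) from rfl,
      ← Measure.map_map e.continuous.measurable
        (A.toLinearEquiv : V →ₗ[ℝ] V).continuous_of_finiteDimensional.measurable,
      map_linearMap_addHaar_eq_smul_addHaar (volume : Measure V) hdet, Measure.map_smul]
  rw [h1, windowConst_smul_toReal h hlie, ENNReal.toReal_ofReal (abs_nonneg _), abs_inv, div_inv_eq_mul, mul_comm]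

omit [CompleteSpace 𝔸] [IsTopologicalGroup G] [CompactSpace G] [BorelSpace G] in
/-- An isometric change of the model space does not change `σ₀`: for a linear isometry `ι : W ≃ₗᵢ V`,
`σ₀(vol_W ∘ (e ∘ ι)⁻¹) = σ₀(vol_V ∘ e⁻¹)` (`ι` is volume-preserving). [cite: Helgason2000, Ch. I §1 Thm 1.14 (13) p. 96] -/
theorem windowConst_map_frame_comp_linearIsometryEquiv {W : Type*} [NormedAddCommGroup W] [InnerProductSpace ℝ W]
    [FiniteDimensional ℝ W] [MeasurableSpace W] [BorelSpace W] (e : V ≃L[ℝ] C.lie) (ι : W ≃ₗᵢ[ℝ] V) (s : ℝ) :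
    h.chartMeasure hlie ((volume : Measure W).map fun w => e (ι w)) s = h.chartMeasure hlie ((volume : Measure V).map e) s := by
  rw [show (fun w => e (ι w)) = (e : V → C.lie) ∘ (ι : W → V) from rfl,
    ← Measure.map_map e.continuous.measurable ι.continuous.measurable, ι.measurePreserving.map_eq]

end Frame

/-! ## §3 (W-N2) The product formula `σ₀(G^B) = σ₀(G)^{|B|}` -/

section Pi

variable (B : Type*) [Fintype B]

omit [FiniteDimensional ℝ C.lie] [MeasurableSpace C.lie] [BorelSpace C.lie] in
/-- The norm of `𝔤^B ⊆ 𝔸^B` is the sup norm: `‖A‖ < r ↔ ∀ b, ‖A(b)‖ < r` (`r > 0`).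
[cite: Helgason2000, Ch. I §1 Thm 1.14 p. 96] -/
theorem norm_lt_iff_pi {r : ℝ} (hr : 0 < r) (A : (piLogChart C B).lie) :
    ‖A‖ < r ↔ ∀ b, ‖lieApply C B A b‖ < r := by
  rw [Submodule.coe_norm, pi_norm_lt_iff hr]
  exact Iff.rfl

omit [IsTopologicalGroup G] [CompactSpace G] [MeasurableSpace G] [BorelSpace G] [FiniteDimensional ℝ C.lie]
  [MeasurableSpace C.lie] [BorelSpace C.lie] in
/-- **The product window is the product of the windows**: `V^{(B)}_r = Π_b V_r` (`r > 0`), because the product chart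
is componentwise (`expChart_pi_apply`) and its ball is the product of balls (sup norm).
[cite: Helgason2000, Ch. I §1 Thm 1.14 (13) p. 96] [cite: Balaban1985UV3, (18) p. 260] -/
theorem window_pi_eq {r : ℝ} (hr : 0 < r) :
    (isChartRep_pi B h).window r = Set.pi Set.univ fun _ : B => h.window r := by
  ext g
  simp only [IsChartRep.window, Set.mem_image, Set.mem_pi, Set.mem_univ, true_implies, mem_ball_zero_iff]
  constructor
  · rintro ⟨A, hA, rfl⟩ b
    exact ⟨lieApply C B A b, (norm_lt_iff_pi B hr A).1 hA b, (expChart_pi_apply B h A b).symm⟩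
  · intro hg
    choose X hX hXg using hg
    refine ⟨(lieEquivPi C B).symm X, ?_, ?_⟩
    · rw [norm_lt_iff_pi B hr]
      intro b
      have : lieApply C B ((lieEquivPi C B).symm X) b = X b := congrFun ((lieEquivPi C B).apply_symm_apply X) b
      rw [this]
      exact hX b
    · funext b
      rw [expChart_pi_apply B h]
      have : lieApply C B ((lieEquivPi C B).symm X) b = X b := congrFun ((lieEquivPi C B).apply_symm_apply X) b
      rw [this, hXg b]

omit [FiniteDimensional ℝ C.lie] [MeasurableSpace C.lie] [BorelSpace C.lie] in
/-- The ball of `𝔤^B` read through `lieEquivPi` is the product of balls (`r > 0`). [cite: Helgason2000, Ch. I §1 Thm 1.14 p. 96] -/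
theorem lieEquivPi_symm_preimage_ball {r : ℝ} (hr : 0 < r) :
    (fun X : B → C.lie => (lieEquivPi C B).symm X) ⁻¹' ball (0 : (piLogChart C B).lie) r =
      Set.pi Set.univ fun _ : B => ball (0 : C.lie) r := by
  ext X
  simp only [Set.mem_preimage, mem_ball_zero_iff, Set.mem_pi, Set.mem_univ, true_implies]
  rw [norm_lt_iff_pi B hr]
  refine forall_congr' fun b => ?_
  have : lieApply C B ((lieEquivPi C B).symm X) b = X b := congrFun ((lieEquivPi C B).apply_symm_apply X) b
  rw [this]

/-- ★★ **PRODUCT FORMULA FOR THE WINDOW CONSTANT**: `σ₀(G^B; λ_B) = σ₀(G; η)^{|B|}` where the product group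
`G^B` carries the product Haar measure `⊗_b μ`, its chart is the product chart `isChartRep_pi B h`, and the
reference measure `λ_B` on `𝔤^B` is the product `⊗_b η` transported along `lieEquivPi : 𝔤^B ≃ (B → 𝔤)`
(print's factor `σ₀^{|Ω₁|}` in (18)).  Both sides are the `r → 0⁺` limits of `μ_B(V^B_r) ∕ λ_B(B(0,r))` resp.
`(μ(V_r) ∕ η(B(0,r)))^{|B|}`, which agree for `r > 0` by `window_pi_eq` and `Measure.pi_pi`.
[cite: Balaban1985UV3, (18) p. 260 (`exp[… + log σ₀ |Ω₁|]`)] [cite: Helgason2000, Ch. I §1 Thm 1.14 (13) p. 96] -/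
theorem windowConst_pi_toReal [SecondCountableTopology G] [FiniteDimensional ℝ (piLogChart C B).lie]
    [MeasurableSpace (piLogChart C B).lie] [BorelSpace (piLogChart C B).lie] :
    ((Measure.pi fun _ : B => μ) ((isChartRep_pi B h).window (IsChartRep.chartRadius (piLogChart C B))) /
        (isChartRep_pi B h).chartMeasure (lie_adStable_pi C B hlie)
          ((Measure.pi fun _ : B => η).map fun X : B → C.lie => (lieEquivPi C B).symm X)
          (IsChartRep.chartRadius (piLogChart C B))
          ((isChartRep_pi B h).window (IsChartRep.chartRadius (piLogChart C B)))).toReal =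
      (μ (h.window (IsChartRep.chartRadius C)) /
          h.chartMeasure hlie η (IsChartRep.chartRadius C) (h.window (IsChartRep.chartRadius C))).toReal ^
        Fintype.card B := by
  have hcont : Continuous fun X : B → C.lie => (lieEquivPi C B).symm X :=
    (lieEquivPi C B).symm.toLinearMap.continuous_of_finiteDimensional
  have hmeas : Measurable fun X : B → C.lie => (lieEquivPi C B).symm X := hcont.measurable
  haveI : ((Measure.pi fun _ : B => η).map fun X : B → C.lie => (lieEquivPi C B).symm X).IsAddHaarMeasure :=
    (lieEquivPi C B).symm.toContinuousLinearEquiv.isAddHaarMeasure_map _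
  set lamB : Measure (piLogChart C B).lie :=
    (Measure.pi fun _ : B => η).map fun X : B → C.lie => (lieEquivPi C B).symm X with hlamB
  -- the two limits of §1
  have hB := tendsto_haar_window_div (isChartRep_pi B h) (lie_adStable_pi C B hlie) lamB (Measure.pi fun _ : B => μ)
    (IsChartRep.chartRadius_pos (C := piLogChart C B)) le_rfl
  have h1 := tendsto_haar_window_div h hlie η μ (IsChartRep.chartRadius_pos (C := C)) le_rfl
  have h1' := h1.pow (Fintype.card B)
  -- the two sequences agree for `r > 0`
  have heq : ∀ r : ℝ, 0 < r →
      ((Measure.pi fun _ : B => μ) ((isChartRep_pi B h).window r)).toReal / (lamB (ball (0 : (piLogChart C B).lie) r)).toReal =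
        ((μ (h.window r)).toReal / (η (ball (0 : C.lie) r)).toReal) ^ Fintype.card B := by
    intro r hr
    rw [window_pi_eq h B hr, Measure.pi_pi, hlamB, Measure.map_apply hmeas measurableSet_ball,
      lieEquivPi_symm_preimage_ball B hr, Measure.pi_pi]
    simp only [Finset.prod_const, Finset.card_univ, ENNReal.toReal_pow, div_pow]
  have hB' : Tendsto (fun r : ℝ => ((μ (h.window r)).toReal / (η (ball (0 : C.lie) r)).toReal) ^ Fintype.card B)
      (𝓝[>] 0) (𝓝 ((Measure.pi fun _ : B => μ) ((isChartRep_pi B h).window (IsChartRep.chartRadius (piLogChart C B))) /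
        (isChartRep_pi B h).chartMeasure (lie_adStable_pi C B hlie) lamB (IsChartRep.chartRadius (piLogChart C B))
          ((isChartRep_pi B h).window (IsChartRep.chartRadius (piLogChart C B)))).toReal) := by
    refine hB.congr' ?_
    filter_upwards [self_mem_nhdsWithin] with r hr
    exact heq r hr
  exact tendsto_nhds_unique hB' h1'

end Pi

end Literature.MathematicalPhysics.QuantumFieldTheory.Balaban1983to89.HaarWindowConstLimit
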